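import Summits.QuantumFields.BalabanUV.T4Continuum.Support.NE3TangentNoGoForms
import Summits.QuantumFields.BalabanUV.T4Continuum.Support.NE3EnergyWeightedShapes
import Mathlib.Analysis.SpecialFunctions.Trigonometric.Bounds
import HarnessLib

/-!
# T⁴ programme, node NE3 — NO-GO: there is NO k-UNIFORM TANGENT COERCIVITY of the Wilson Hessian in the UNIT-SCALE energy
# norm on the k-fold tangent space at the flat background (located error G-ne3p1-g19-1, kernel form)

NE3 prover lineage P1, gen 19 (cell `pub-balaban`, unit `b2b-balaban-t4-ne3-p1`, row NE3 OWNER).  The energy-convexity road to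
T-E (route P2's skeleton `t4/skeletons/NE3-t4-ne3-p2.md` §L5, shared by route P3) asks for «`hessForm W X X ≥ c_T·N_W(X)²` on the
tangent space T(W) ∋ `TangentIter L (k−1) W X`, with `c_T` depending on `(d, L, n)` only», `N_W = NE3EnergyShapes.energyNorm`
(curlSq + dirSq, UNIT-SCALE weight), and its END `NE3EnergyAssembly.ne3EnergyRate_of_routeLeaves` binds ONE `c` for all levels
k.  THIS FILE PROVES THAT NO SUCH `c` EXISTS ALREADY AT THE FLAT BACKGROUND `W = 1`: for `d ≥ 2`, `L ≥ 2`, every `N ≥ 1` and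
every `k` with `L^k ≥ 3`, the wave witness `X_k = wave 0 i₁ L^{−k} 1 0` of part 2 (`cos(2πx_{i₁}/L^k)·(i·1)` on the direction-0
bonds) is skew, `(N·L^k)`-periodic, divergence-free (Landau at `W = 1`), lies in `TangentIter L (k−1) 1` (part 2), is non-zero,
and satisfies
  `hess 1 X_k X_k (perWin d (N·L^k)) = curlSq 1 X_k F = 4 sin²(π/L^k)·dirSq X_k F ≤ 4 sin²(π/L^k)·energyNorm 1 X_k F²`
(`F = periodBox (N·L^k)`), hence `hess/energyNorm² ≤ 4π²·L^{−2k}` — **`no_uniform_tangent_coercivity`**: for every `c > 0` there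
is a level k and a tangent direction violating `c·energyNorm² ≤ hess`.  (At the flat background `hess 1 Y Y ≤ Σ‖curl‖²` in general;
for central `Y` the Hessian IS `curlSq`; the unit-scale `dirSq` of a direction varying on the scale `L^k` of the coarsest constraint
dominates its `curlSq` by the factor `(L^k/π)²/4` — the Poincaré constant the road's bookkeeping «η-units absorbed» dropped.)

CONTENT (0 def, 0 sorry; the witness, its tangency and its forms are parts 1–3 `NE3TangentNoGoWords` ∕ `…Flat` ∕ `…Forms`):
**`hess_wave_le`** (`hess = 4 sin²(π/L^k)·dirSq ≤ (4π²/(L^k)²)·energyNorm²`), **`no_uniform_tangent_coercivity`**, and the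
complementary sanity statement in the η-WEIGHTED currency of the repair census (R3): **`hess_wave_ge_weighted`** — the SAME witness
satisfies `hess ≥ (16/17)·energyNormW L k …²` with a k-FREE constant (`NE3EnergyWeightedShapes.energyNormW`, Jordan's inequality):
the defect is the unit-scale weight, not the witness.

HONEST FRAMING.  A NO-GO about OUR OWN proof frame (the typed leaf L5 of routes P2/P3), at the flat configuration, by explicit
witness; NOTHING about Bałaban's minimisers is asserted; T-E itself is NOT refuted (only this road to it); (H∃) untouched; NE3 NOT
proved; spine 0∕9; finite T⁴ rung (B)+1 — NOT infinite volume, NOT mass gap, NOT Clay.  PLACEMENT: `Summits/QuantumFields/BalabanUV/`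
(our no-go).  Repair census: HOME/GAPS.md G-ne3p1-g19-1 (weighted norm + curl-paired residual).
-/

set_option autoImplicit false

open scoped BigOperators Matrix.Norms.L2Operator
open Finset

namespace Summit.QuantumFields.BalabanUV.T4Continuum.NE3TangentNoGo

open Literature.MathematicalPhysics.QuantumFieldTheory.Balaban1983to89
open B7Prop1Explicit B7Prop2Explicit UnitaryModel
open T4AveragingDeficitWall hiding Site Plane Plaq Bond
open T4AveragingDeficitWallBoundary (periodBox mem_periodBox)
open AveragingDeficitPeriodicCounting (IsPeriodicDir)
open AveragingDeficitMultiLevelPrep (TangentIter)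
open BlockAveragePushDirSplit (flat)
open MinimalActionLevels (perWin)
open NE3HessForm (hess hessPlaq hessPlaqAt dcurlAt)
open NE3EnergyShapes (energyNorm)
open NE3EnergyWeightedShapes (energyNormW)
open NE3TangentNoGoWords NE3TangentNoGoFlat NE3TangentNoGoForms

noncomputable section

variable {d : ℕ} {n : Type*} [Fintype n] [DecidableEq n]

variable {i₀ i₁ : Fin d}

/-! ## §4 The no-go -/

/-- **THE HESSIAN OF THE WITNESS IS SMALL IN THE UNIT-SCALE ENERGY NORM**: for `d = m + 2 ≥ 2` (`i₀ = 0 ≠ i₁`), `L ≥ 2`,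
`L^k ≥ 3`, every `N ≥ 1`, with `P = N·L^k`, `F = periodBox P`:
`hess 1 X_k X_k (perWin d P) = 4 sin²(π/L^k)·dirSq X_k F ≤ (4π²/(L^k)²)·energyNorm 1 X_k F²`. [folklore] -/
theorem hess_wave_le [Nonempty n] {m : ℕ} {i₀ i₁ : Fin (m + 2)} (h0 : (i₀ : ℕ) = 0) (h01 : i₀ ≠ i₁) {L : ℕ}
    (hL : 2 ≤ L) {k : ℕ} (hk : 3 ≤ L ^ k) (N : ℕ) :
    hess (flat (d := m + 2) (n := n)) (Xw n i₀ i₁ L k) (Xw n i₀ i₁ L k) (perWin (m + 2) (N * L ^ k))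
      = 4 * Real.sin (Real.pi / (L : ℝ) ^ k) ^ 2 * dirSq (Xw n i₀ i₁ L k) (periodBox (N * L ^ k)) ∧
    hess (flat (d := m + 2) (n := n)) (Xw n i₀ i₁ L k) (Xw n i₀ i₁ L k) (perWin (m + 2) (N * L ^ k))
      ≤ (4 * Real.pi ^ 2 / ((L : ℝ) ^ k) ^ 2)
        * energyNorm (flat (d := m + 2) (n := n)) (Xw n i₀ i₁ L k) (periodBox (N * L ^ k)) ^ 2 := by
  have hMP : L ^ k ∣ N * L ^ k := dvd_mul_left _ _
  obtain ⟨hS1, hS2⟩ := trig_sums hk hMP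
  have hcast : ((L ^ k : ℕ) : ℝ) = (L : ℝ) ^ k := by push_cast; ring
  rw [hcast] at hS1 hS2
  have hH : hess (flat (d := m + 2) (n := n)) (Xw n i₀ i₁ L k) (Xw n i₀ i₁ L k) (perWin (m + 2) (N * L ^ k))
      = 4 * Real.sin (Real.pi / (L : ℝ) ^ k) ^ 2 * dirSq (Xw n i₀ i₁ L k) (periodBox (N * L ^ k)) := by
    rw [hess_flat_Xw_eq_curlSq, curlSq_Xw h0 h01, dirSq_Xw, hS1, hS2]; ring
  refine ⟨hH, ?_⟩
  rw [hH]
  have hD0 : 0 ≤ dirSq (Xw n i₀ i₁ L k) (periodBox (d := m + 2) (N * L ^ k)) := by unfold dirSq; positivity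
  have hC0 : 0 ≤ curlSq (flat (d := m + 2) (n := n)) (Xw n i₀ i₁ L k) (periodBox (N * L ^ k)) := by
    unfold curlSq; positivity
  have hE : energyNorm (flat (d := m + 2) (n := n)) (Xw n i₀ i₁ L k) (periodBox (N * L ^ k)) ^ 2
      = curlSq flat (Xw n i₀ i₁ L k) (periodBox (N * L ^ k)) + dirSq (Xw n i₀ i₁ L k) (periodBox (N * L ^ k)) := by
    unfold NE3EnergyShapes.energyNorm; rw [Real.sq_sqrt (by positivity)]
  rw [hE]
  have hLk : (0 : ℝ) < (L : ℝ) ^ k := by positivity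
  have hsin : Real.sin (Real.pi / (L : ℝ) ^ k) ^ 2 ≤ (Real.pi / (L : ℝ) ^ k) ^ 2 := by
    have h1 : 0 ≤ Real.pi / (L : ℝ) ^ k := by positivity
    have h2 : Real.sin (Real.pi / (L : ℝ) ^ k) ≤ Real.pi / (L : ℝ) ^ k := Real.sin_le h1
    have h3 : 0 ≤ Real.sin (Real.pi / (L : ℝ) ^ k) := by
      refine Real.sin_nonneg_of_nonneg_of_le_pi h1 ?_
      rw [div_le_iff₀ hLk]
      have : (1 : ℝ) ≤ (L : ℝ) ^ k := one_le_pow₀ (by exact_mod_cast (by omega : 1 ≤ L))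
      nlinarith [Real.pi_pos]
    exact pow_le_pow_left₀ h3 h2 2
  have e : 4 * Real.pi ^ 2 / ((L : ℝ) ^ k) ^ 2 = 4 * (Real.pi / (L : ℝ) ^ k) ^ 2 := by
    field_simp
  rw [e]
  nlinarith [mul_nonneg (mul_nonneg (by norm_num : (0:ℝ) ≤ 4) (sq_nonneg (Real.pi / (L : ℝ) ^ k))) hC0]

/-- **NO k-UNIFORM TANGENT COERCIVITY IN THE UNIT-SCALE ENERGY NORM** (located error G-ne3p1-g19-1, kernel form).  For `d ≥ 2`
(directions `i₀ = 0 ≠ i₁`), `L ≥ 2`, every torus factor `N ≥ 1` and EVERY constant `c > 0` there is a level `k ≥ 1` and a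
direction `X` on the run-A lattice of period `N·L^k` which is skew, periodic, divergence-free, a k-FOLD TANGENT VECTOR at the
flat background (`TangentIter L (k−1) 1 X`), non-zero, and whose Wilson Hessian at the flat background is BELOW `c` times its
squared unit-scale energy norm: `hess 1 X X (perWin d (N·L^k)) < c · energyNorm 1 X (periodBox (N·L^k))²`.  Hence the leaf
«`hessForm W Y Y ≥ c_T·N_W(Y)²` on the k-fold tangent space with `c_T(d, L, n)`» of the energy-convexity road is FALSE at `W = 1`.
Nothing about Bałaban's minimisers is asserted; T-E is NOT refuted, only this road to it. [folklore] -/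
theorem no_uniform_tangent_coercivity [Nonempty n] {m : ℕ} {i₀ i₁ : Fin (m + 2)} (h0 : (i₀ : ℕ) = 0) (h01 : i₀ ≠ i₁)
    {L : ℕ} (hL : 2 ≤ L) {N : ℕ} (hN : 1 ≤ N) {c : ℝ} (hc : 0 < c) :
    ∃ k : ℕ, 1 ≤ k ∧ ∃ X : Site (m + 2) → Fin (m + 2) → Matrix n n ℂ,
      IsSkewDir X ∧ IsPeriodicDir X ((N * L ^ k : ℕ) : ℤ) ∧ TangentIter L (k - 1) (flat (d := m + 2) (n := n)) X ∧
      (∀ x : Site (m + 2), ∑ μ : Fin (m + 2), (X x μ - X (x - e μ) μ) = 0) ∧ X ≠ 0 ∧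
      0 < energyNorm (flat (d := m + 2) (n := n)) X (periodBox (N * L ^ k)) ∧
      hess (flat (d := m + 2) (n := n)) X X (perWin (m + 2) (N * L ^ k))
        < c * energyNorm (flat (d := m + 2) (n := n)) X (periodBox (N * L ^ k)) ^ 2 := by
  have hL1 : (1 : ℝ) < L := by exact_mod_cast (by omega : 1 < L)
  -- choose k with `4π²/(L^k)² < c` and `L^k ≥ 3`
  obtain ⟨k₀, hk₀⟩ := pow_unbounded_of_one_lt (max 3 (4 * Real.pi ^ 2 / c + 1)) hL1
  set k : ℕ := k₀ + 1 with hkdef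
  have hLk₀ : max 3 (4 * Real.pi ^ 2 / c + 1) < (L : ℝ) ^ k := by
    refine hk₀.trans_le ?_
    rw [hkdef, pow_succ]
    have : (1 : ℝ) ≤ (L : ℝ) ^ k₀ := one_le_pow₀ hL1.le
    nlinarith
  have hk3 : 3 ≤ L ^ k := by
    have : (3 : ℝ) < (L : ℝ) ^ k := (le_max_left _ _).trans_lt hLk₀
    exact_mod_cast this.le
  have hLk : (0 : ℝ) < (L : ℝ) ^ k := by positivity
  have hsmall : 4 * Real.pi ^ 2 / ((L : ℝ) ^ k) ^ 2 < c := by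
    have h1 : 4 * Real.pi ^ 2 / c + 1 < (L : ℝ) ^ k := (le_max_right _ _).trans_lt hLk₀
    have h2 : 4 * Real.pi ^ 2 / c < ((L : ℝ) ^ k) ^ 2 := by nlinarith
    rw [div_lt_iff₀ (by positivity)]
    rw [div_lt_iff₀ hc] at h2
    linarith
  -- the energy norm of the witness is positive: `dirSq = P^{m+1}·P/2 > 0`
  have hEpos : 0 < energyNorm (flat (d := m + 2) (n := n)) (Xw n i₀ i₁ L k) (periodBox (N * L ^ k)) := by
    have hMP : L ^ k ∣ N * L ^ k := dvd_mul_left _ _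
    have hS1 := (trig_sums hk3 hMP).1
    have hcast : ((L ^ k : ℕ) : ℝ) = (L : ℝ) ^ k := by push_cast; ring
    rw [hcast] at hS1
    have hP : (0 : ℝ) < ((N * L ^ k : ℕ) : ℝ) := by
      have : 0 < N * L ^ k := Nat.mul_pos (by omega) (by positivity)
      exact_mod_cast this
    have hDpos : 0 < dirSq (Xw n i₀ i₁ L k) (periodBox (d := m + 2) (N * L ^ k)) := by
      rw [dirSq_Xw, hS1]; positivity
    have hC0 : 0 ≤ curlSq (flat (d := m + 2) (n := n)) (Xw n i₀ i₁ L k) (periodBox (N * L ^ k)) := by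
      unfold curlSq; positivity
    unfold NE3EnergyShapes.energyNorm
    exact Real.sqrt_pos.mpr (by linarith)
  refine ⟨k, by omega, Xw n i₀ i₁ L k, isSkewDir_Xw L k, isPeriodicDir_Xw (by omega) N k,
    tangentIter_Xw h0 h01 hL (by omega), div_Xw_eq_zero h01 L k, Xw_ne_zero L k, hEpos, ?_⟩
  exact (hess_wave_le (n := n) h0 h01 hL hk3 N).2.trans_lt (mul_lt_mul_of_pos_right hsmall (pow_pos hEpos 2))


/-- **IN THE η-WEIGHTED CURRENCY THE WITNESS IS HARMLESS, k-UNIFORMLY**: with `energyNormW L k` (= √(curlSq + (L^k)⁻²·dirSq),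
`NE3EnergyWeightedShapes`) the same witness satisfies `(16/17)·energyNormW 1 X_k F² ≤ hess 1 X_k X_k (perWin d P)` for every
`k` with `L^k ≥ 3` (`hess = 4 sin²(π/L^k)·dirSq`, `energyNormW² = (4 sin²(π/L^k) + (L^k)⁻²)·dirSq`, and Jordan's inequality
`sin(π/M) ≥ 2/M`).  The defect located by `no_uniform_tangent_coercivity` is the unit-scale WEIGHT of the road's norm, not a
property of the direction: the repair census (R3) re-types the road in this currency. [folklore] -/
theorem hess_wave_ge_weighted [Nonempty n] {m : ℕ} {i₀ i₁ : Fin (m + 2)} (h0 : (i₀ : ℕ) = 0) (h01 : i₀ ≠ i₁) {L : ℕ}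
    (hL : 2 ≤ L) {k : ℕ} (hk : 3 ≤ L ^ k) (N : ℕ) :
    (16 / 17 : ℝ) * energyNormW L k (flat (d := m + 2) (n := n)) (Xw n i₀ i₁ L k) (periodBox (N * L ^ k)) ^ 2
      ≤ hess (flat (d := m + 2) (n := n)) (Xw n i₀ i₁ L k) (Xw n i₀ i₁ L k) (perWin (m + 2) (N * L ^ k)) := by
  obtain ⟨hH, -⟩ := hess_wave_le (n := n) h0 h01 hL hk N
  have hMP : L ^ k ∣ N * L ^ k := dvd_mul_left _ _
  obtain ⟨hS1, hS2⟩ := trig_sums hk hMP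
  have hcast : ((L ^ k : ℕ) : ℝ) = (L : ℝ) ^ k := by push_cast; ring
  rw [hcast] at hS1 hS2
  -- `curlSq = 4 sin² · dirSq`
  have hC : curlSq (flat (d := m + 2) (n := n)) (Xw n i₀ i₁ L k) (periodBox (N * L ^ k))
      = 4 * Real.sin (Real.pi / (L : ℝ) ^ k) ^ 2 * dirSq (Xw n i₀ i₁ L k) (periodBox (N * L ^ k)) := by
    rw [← hess_flat_Xw_eq_curlSq, hH]
  have hD0 : 0 ≤ dirSq (Xw n i₀ i₁ L k) (periodBox (d := m + 2) (N * L ^ k)) := by unfold dirSq; positivity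
  have hEw : energyNormW L k (flat (d := m + 2) (n := n)) (Xw n i₀ i₁ L k) (periodBox (N * L ^ k)) ^ 2
      = (4 * Real.sin (Real.pi / (L : ℝ) ^ k) ^ 2 + (((L : ℝ) ^ k)⁻¹) ^ 2)
        * dirSq (Xw n i₀ i₁ L k) (periodBox (N * L ^ k)) := by
    have hC0 : 0 ≤ curlSq (flat (d := m + 2) (n := n)) (Xw n i₀ i₁ L k) (periodBox (N * L ^ k)) := by
      unfold curlSq; positivity
    unfold NE3EnergyWeightedShapes.energyNormW
    rw [Real.sq_sqrt (by positivity), hC]; ring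
  rw [hH, hEw]
  -- Jordan: `sin(π/M) ≥ (2/π)(π/M) = 2/M`
  have hM3 : (3 : ℝ) ≤ (L : ℝ) ^ k := by exact_mod_cast hk
  have hM0 : (0 : ℝ) < (L : ℝ) ^ k := by positivity
  have hx0 : 0 ≤ Real.pi / (L : ℝ) ^ k := by positivity
  have hx1 : Real.pi / (L : ℝ) ^ k ≤ Real.pi / 2 := by
    rw [div_le_div_iff_of_pos_left Real.pi_pos hM0 (by norm_num)]; linarith
  have hJ := Real.mul_le_sin hx0 hx1
  have hJ' : 2 / (L : ℝ) ^ k ≤ Real.sin (Real.pi / (L : ℝ) ^ k) := by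
    have : 2 / Real.pi * (Real.pi / (L : ℝ) ^ k) = 2 / (L : ℝ) ^ k := by field_simp
    rw [← this]; exact hJ
  have hs0 : 0 ≤ 2 / (L : ℝ) ^ k := by positivity
  have hsq : (2 / (L : ℝ) ^ k) ^ 2 ≤ Real.sin (Real.pi / (L : ℝ) ^ k) ^ 2 := pow_le_pow_left₀ hs0 hJ' 2
  have hinv : (((L : ℝ) ^ k)⁻¹) ^ 2 = (2 / (L : ℝ) ^ k) ^ 2 / 4 := by field_simp; ring
  rw [hinv]
  nlinarith [sq_nonneg (2 / (L : ℝ) ^ k), hsq, hD0]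

end

end Summit.QuantumFields.BalabanUV.T4Continuum.NE3TangentNoGo
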